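import Summits.ResolutionOfSingularities.ResolutionOfSingularities.Theorems.FrobeniusClosingSteerBetaLetterPush
import HarnessLib

/-!
# Crux `Steer` (stmt-ResolutionOfSingularities-16345), chain W4.1, β-LEAF (hK4′), K-β2♭ part (I), file 2: identifications of
# idea-1's threshold ideals (`AlphaGe` / `DeltaGe` / `BetaGe` bodies) with the monomial-region ideals of
# `…BetaLetterPush.lean` (Theses-free, def-free research support)

OURS (campaign `res-hironaka`, rung L ★L-G4, slot W4.1; statements about the route's own objects; they replace the
role of no printed item and are NOT statements of the manuscript under review [claim: Hironaka2017, status: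
under-review]; AI review is weaker than expert review). Seat res-D-pv-003 (gen 6), K-β2♭ kernel owner (res-L0-w41-plan-1
RULINGS 140/143/148a). `poly_alpha_le` / `poly_alpha_le'` / `poly_beta_le`: a region ideal of the `α`- / `β`-shape is
contained in the corresponding threshold ideal (so the CONCLUSIONS of the representative-level laws yield `AlphaGe` /
`BetaGe` downstairs); `delta_le_poly` (via `span_pair_pow_le_iSup`: `(x, y)^e ⊆ Σ_{a+b=e} (x^a y^b)`): the `δ`-threshold
ideal is contained in the region ideal `⌈ρ n⌉ ≤ a + b` (so `DeltaGe` upstairs FEEDS `alpha_x_letter`). The WORDS-LEVEL forms over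
the tree words `BetaPolygon.AlphaGe` / `DeltaGe` / `BetaGe` (res-L0-w41-stub-1's `…BetaPolygonWords`) are file 3 `…BetaLetterWords.lean`. No Theses file is
imported; nothing here is a route item or a registration. [cite: CossartJannsenSaito2020, Definition 11.1]
-/

noncomputable section

-- `Summit.<S>.<S>.…` duplicates the summit name by design (single-problem summit).
set_option linter.dupNamespace false

namespace Summit.ResolutionOfSingularities.ResolutionOfSingularities.Theorems.SwitchingDichotomy.BetaLetter

variable {S S₁ : Type*} [CommRing S] [CommRing S₁]

/-! ## §4 Identifications with idea-1's threshold ideals (`AlphaGe` / `DeltaGe` / `BetaGe` bodies) -/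

section Ident

/-- Region ideal `⌈ρ n⌉ ≤ a` (abscissa only) IS idea-1's `α`-threshold summand generator-wise: every monomial of the
region is a multiple of `x^⌈ρ n⌉ zⁱ wʲ`, so `Poly ≤ AlphaGe-ideal`. [folklore] -/
theorem poly_alpha_le (x z₁ w₁ : S₁) (d : ℕ) (ρ : ℚ) :
    (Ideal.span {z₁, w₁} ^ d ⊔ ⨆ (i : ℕ) (j : ℕ) (_ : i + j < d) (a : ℕ)
      (_ : ⌈ρ * ((d - i - j : ℕ) : ℚ)⌉₊ ≤ a), Ideal.span {x ^ a * z₁ ^ i * w₁ ^ j}) ≤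
    Ideal.span {z₁, w₁} ^ d ⊔ ⨆ (i : ℕ) (j : ℕ) (_ : i + j < d),
      Ideal.span {x ^ ⌈ρ * ((d - i - j : ℕ) : ℚ)⌉₊ * z₁ ^ i * w₁ ^ j} := by
  refine sup_le le_sup_left (iSup_le fun i => iSup_le fun j => iSup_le fun hij => iSup_le fun a => iSup_le fun ha => ?_)
  refine le_sup_right.trans' (le_iSup_of_le i (le_iSup_of_le j (le_iSup_of_le hij ?_)))
  refine Ideal.span_singleton_le_span_singleton.mpr ?_
  exact mul_dvd_mul (mul_dvd_mul (pow_dvd_pow x ha) (dvd_refl _)) (dvd_refl _)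

/-- The same for the y-letter's output shape (`x₁^a (φ y)^b zⁱ wʲ` with `⌈ρ n⌉ ≤ a`). [folklore] -/
theorem poly_alpha_le' (x₁ t z₁ w₁ : S₁) (d : ℕ) (ρ : ℚ) :
    (Ideal.span {z₁, w₁} ^ d ⊔ ⨆ (i : ℕ) (j : ℕ) (_ : i + j < d) (a : ℕ) (b : ℕ)
      (_ : ⌈ρ * ((d - i - j : ℕ) : ℚ)⌉₊ ≤ a), Ideal.span {x₁ ^ a * t ^ b * z₁ ^ i * w₁ ^ j}) ≤
    Ideal.span {z₁, w₁} ^ d ⊔ ⨆ (i : ℕ) (j : ℕ) (_ : i + j < d),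
      Ideal.span {x₁ ^ ⌈ρ * ((d - i - j : ℕ) : ℚ)⌉₊ * z₁ ^ i * w₁ ^ j} := by
  refine sup_le le_sup_left (iSup_le fun i => iSup_le fun j => iSup_le fun hij => iSup_le fun a => iSup_le fun b =>
    iSup_le fun ha => ?_)
  refine le_sup_right.trans' (le_iSup_of_le i (le_iSup_of_le j (le_iSup_of_le hij ?_)))
  refine Ideal.span_singleton_le_span_singleton.mpr ?_
  calc x₁ ^ ⌈ρ * ((d - i - j : ℕ) : ℚ)⌉₊ * z₁ ^ i * w₁ ^ j ∣ x₁ ^ a * z₁ ^ i * w₁ ^ j :=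
        mul_dvd_mul (mul_dvd_mul (pow_dvd_pow x₁ ha) (dvd_refl _)) (dvd_refl _)
    _ ∣ x₁ ^ a * t ^ b * z₁ ^ i * w₁ ^ j := ⟨t ^ b, by ring⟩

/-- Region ideal of the `β`-shape IS contained in idea-1's `β`-threshold ideal `BetaGe` body. [folklore] -/
theorem poly_beta_le (x v z₁ w₁ : S₁) (d : ℕ) (α ρ : ℚ) :
    (Ideal.span {z₁, w₁} ^ d ⊔ ⨆ (i : ℕ) (j : ℕ) (_ : i + j < d) (a : ℕ) (b : ℕ)
      (_ : ⌊α * ((d - i - j : ℕ) : ℚ)⌋₊ + 1 ≤ a ∨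
        (⌈α * ((d - i - j : ℕ) : ℚ)⌉₊ ≤ a ∧ ⌈ρ * ((d - i - j : ℕ) : ℚ)⌉₊ ≤ b)),
      Ideal.span {x ^ a * v ^ b * z₁ ^ i * w₁ ^ j}) ≤
    Ideal.span {z₁, w₁} ^ d ⊔ ⨆ (i : ℕ) (j : ℕ) (_ : i + j < d),
      (Ideal.span {x ^ (⌊α * ((d - i - j : ℕ) : ℚ)⌋₊ + 1) * z₁ ^ i * w₁ ^ j} ⊔
        Ideal.span {x ^ ⌈α * ((d - i - j : ℕ) : ℚ)⌉₊ * v ^ ⌈ρ * ((d - i - j : ℕ) : ℚ)⌉₊ * z₁ ^ i * w₁ ^ j}) := by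
  refine sup_le le_sup_left (iSup_le fun i => iSup_le fun j => iSup_le fun hij => iSup_le fun a => iSup_le fun b =>
    iSup_le fun h => ?_)
  refine le_sup_right.trans' (le_iSup_of_le i (le_iSup_of_le j (le_iSup_of_le hij ?_)))
  rcases h with ha | ⟨ha, hb⟩
  · refine le_sup_left.trans' (Ideal.span_singleton_le_span_singleton.mpr ?_)
    calc x ^ (⌊α * ((d - i - j : ℕ) : ℚ)⌋₊ + 1) * z₁ ^ i * w₁ ^ j ∣ x ^ a * z₁ ^ i * w₁ ^ j :=
          mul_dvd_mul (mul_dvd_mul (pow_dvd_pow x ha) (dvd_refl _)) (dvd_refl _)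
      _ ∣ x ^ a * v ^ b * z₁ ^ i * w₁ ^ j := ⟨v ^ b, by ring⟩
  · refine le_sup_right.trans' (Ideal.span_singleton_le_span_singleton.mpr ?_)
    exact mul_dvd_mul (mul_dvd_mul (mul_dvd_mul (pow_dvd_pow x ha) (pow_dvd_pow v hb)) (dvd_refl _)) (dvd_refl _)

/-- `(x, y)^e ⊆ ⨆_{a + b = e} (x^a y^b)`: a power of the pair ideal is generated by the monomials of total degree `e`.
[folklore] -/
theorem span_pair_pow_le_iSup (x y : S) (e : ℕ) :
    Ideal.span ({x, y} : Set S) ^ e ≤ ⨆ (a : ℕ) (b : ℕ) (_ : a + b = e), Ideal.span {x ^ a * y ^ b} := by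
  induction e with
  | zero =>
    rw [pow_zero, Ideal.one_eq_top]
    refine le_iSup_of_le 0 (le_iSup_of_le 0 (le_iSup_of_le rfl ?_))
    rw [pow_zero, pow_zero, mul_one, Ideal.span_singleton_one]
  | succ e ih =>
    rw [pow_succ]
    refine (Ideal.mul_mono_left ih).trans ?_
    rw [Ideal.iSup_mul]
    refine iSup_le fun a => ?_
    rw [Ideal.iSup_mul]
    refine iSup_le fun b => ?_
    rw [Ideal.iSup_mul]
    refine iSup_le fun hab => ?_
    rw [Ideal.mul_le]
    intro m hm r hr
    obtain ⟨m', rfl⟩ := Ideal.mem_span_singleton'.mp hm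
    obtain ⟨c₁, c₂, rfl⟩ := Ideal.mem_span_pair.mp hr
    have : m' * (x ^ a * y ^ b) * (c₁ * x + c₂ * y) =
        (m' * c₁) * (x ^ (a + 1) * y ^ b) + (m' * c₂) * (x ^ a * y ^ (b + 1)) := by ring
    rw [this]
    refine Ideal.add_mem _ (Ideal.mul_mem_left _ _ ?_) (Ideal.mul_mem_left _ _ ?_)
    · exact Submodule.mem_iSup_of_mem (a + 1) (Submodule.mem_iSup_of_mem b
        (Submodule.mem_iSup_of_mem (by omega) (Ideal.mem_span_singleton_self _)))
    · exact Submodule.mem_iSup_of_mem a (Submodule.mem_iSup_of_mem (b + 1)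
        (Submodule.mem_iSup_of_mem (by omega) (Ideal.mem_span_singleton_self _)))

/-- idea-1's `δ`-threshold ideal (`DeltaGe` body) IS contained in the region ideal `⌈ρ n⌉ ≤ a + b`: the input of
`alpha_x_letter` can be fed from `DeltaGe x y z w d ρ f`. [folklore] -/
theorem delta_le_poly (x y z w : S) (d : ℕ) (ρ : ℚ) :
    (Ideal.span {z, w} ^ d ⊔ ⨆ (i : ℕ) (j : ℕ) (_ : i + j < d),
      Ideal.span {x, y} ^ ⌈ρ * ((d - i - j : ℕ) : ℚ)⌉₊ * Ideal.span {z ^ i * w ^ j}) ≤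
    Ideal.span {z, w} ^ d ⊔ ⨆ (i : ℕ) (j : ℕ) (_ : i + j < d) (a : ℕ) (b : ℕ)
      (_ : ⌈ρ * ((d - i - j : ℕ) : ℚ)⌉₊ ≤ a + b), Ideal.span {x ^ a * y ^ b * z ^ i * w ^ j} := by
  refine sup_le le_sup_left (iSup_le fun i => iSup_le fun j => iSup_le fun hij => ?_)
  refine le_sup_right.trans' (le_iSup_of_le i (le_iSup_of_le j (le_iSup_of_le hij ?_)))
  refine (Ideal.mul_mono_left (span_pair_pow_le_iSup x y _)).trans ?_
  rw [Ideal.iSup_mul]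
  refine iSup_le fun a => ?_
  rw [Ideal.iSup_mul]
  refine iSup_le fun b => ?_
  rw [Ideal.iSup_mul]
  refine iSup_le fun hab => ?_
  rw [Ideal.span_singleton_mul_span_singleton]
  refine le_iSup_of_le a (le_iSup_of_le b (le_iSup_of_le (by omega) ?_))
  refine Ideal.span_singleton_le_span_singleton.mpr ⟨1, by ring⟩

end Ident

end Summit.ResolutionOfSingularities.ResolutionOfSingularities.Theorems.SwitchingDichotomy.BetaLetter

end
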